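import Mathlib
import HarnessLib

/-!
# THE STUDENT-TYPE GAUSSIAN FUNCTIONALS ARE STRICTLY INCREASING IN THE THRESHOLD
# (so a Student-type threshold for a given nominal level is UNIQUE)

HONEST FRAMING: exact (Metropolis-corrected) sampling algorithms for lattice gauge theory;
figures of merit are autocorrelation/cost numbers at stated couplings and volumes; no
continuum-physics claim.

Venture `LatticeQCDFlow` (cell pub-lqcd), topic `Scoring`; FANOUT row 4 (`s0-u1-b`, GEN-32).
NEW WORK of the cell (classical; not in Mathlib), no definition, nothing cited as a fact.

The fixed-batch-count (and fixed-replica-count) coverage limits of the cell are the Gaussian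
functionals `F_a(t) = N(0,1)^{⊗a}{g | a·ḡ² ≤ t²·s²(g)}` (one run) and
`F⁽²⁾_a(t) = (N(0,1)^{⊗a})^{⊗2}{(g, h) | a·(ḡ − h̄)² ≤ t²·(s²(g) + s²(h))}` (two runs / two arms).
This Mathlib-only file proves that both are STRICTLY increasing in `t ≥ 0` when `a ≥ 2`: between
two thresholds `0 ≤ t₁ < t₂` lies the nonempty OPEN set `{t₁²·s² < a·ḡ² < t₂²·s²}`, which a product
of non-degenerate Gaussians charges (`IsOpenPosMeasure`, from `volume ≪ N(0,1)`).  Consequently a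
threshold realising a given nominal level is unique (`Set.InjOn`), which makes "the Student-type
quantile" of the cell's threshold-existence theorems well defined.

## Content

* `strictMonoOn_pi_gaussianReal_student` — `F_a` is strictly increasing on `[0, ∞)` (`a ≥ 2`);
  `injOn_pi_gaussianReal_student` — hence injective there.
* `strictMonoOn_pi_gaussianReal_twoSample_student`, `injOn_pi_gaussianReal_twoSample_student` —
  the same for `F⁽²⁾_a`.

Mathlib only (`gaussianReal_absolutelyContinuous'`, `Measure.pi.isOpenPosMeasure`,
`IsOpen.measure_pos`, `measureReal_sdiff`).  [ours] throughout.
-/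

open MeasureTheory ProbabilityTheory Filter Topology

namespace Summit.Ventures.LatticeQCDFlow.Scoring

section Monotone

/-- An explicit configuration with prescribed Student ratio: for `g = (x+1, x−1, x, …, x)` one has
`∑ g = a·x` and `∑ (gⱼ − ḡ)² = 2`. [ours] -/
theorem student_witness_sums (k : ℕ) (x : ℝ) :
    (∑ i, (Fin.cons (x + 1) (Fin.cons (x - 1) fun _ : Fin k => x) : Fin (k + 1 + 1) → ℝ) i
        = ((k + 1 + 1 : ℕ) : ℝ) * x) ∧
      (∑ j, ((Fin.cons (x + 1) (Fin.cons (x - 1) fun _ : Fin k => x) : Fin (k + 1 + 1) → ℝ) j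
        - (∑ i, (Fin.cons (x + 1) (Fin.cons (x - 1) fun _ : Fin k => x) : Fin (k + 1 + 1) → ℝ) i)
          / ((k + 1 + 1 : ℕ) : ℝ)) ^ 2 = 2) := by
  have hS : (∑ i, (Fin.cons (x + 1) (Fin.cons (x - 1) fun _ : Fin k => x) : Fin (k + 1 + 1) → ℝ) i)
      = ((k + 1 + 1 : ℕ) : ℝ) * x := by
    simp only [Fin.sum_cons, Finset.sum_const, Finset.card_univ, Fintype.card_fin]
    push_cast
    ring
  refine ⟨hS, ?_⟩
  rw [hS]
  have ha : ((k + 1 + 1 : ℕ) : ℝ) ≠ 0 := by positivity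
  have hm : ((k + 1 + 1 : ℕ) : ℝ) * x / ((k + 1 + 1 : ℕ) : ℝ) = x := by field_simp
  rw [hm]
  simp only [Fin.sum_univ_succ, Fin.cons_zero, Fin.cons_succ, Finset.sum_const, Finset.card_univ,
    Fintype.card_fin]
  ring

/-- **`F_a` IS STRICTLY INCREASING ON `[0, ∞)`** (`a ≥ 2`). [ours] -/
theorem strictMonoOn_pi_gaussianReal_student {a : ℕ} (ha : 2 ≤ a) :
    StrictMonoOn (fun t : ℝ => (Measure.pi fun _ : Fin a => gaussianReal 0 1).real
      {g : Fin a → ℝ | (a : ℝ) * ((∑ i, g i) / (a : ℝ)) ^ 2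
          ≤ t ^ 2 * ((∑ j, (g j - (∑ i, g i) / (a : ℝ)) ^ 2) / ((a : ℝ) - 1))}) (Set.Ici 0) := by
  obtain ⟨k, rfl⟩ : ∃ k, a = k + 1 + 1 := ⟨a - 2, by omega⟩
  set μ := Measure.pi fun _ : Fin (k + 1 + 1) => gaussianReal 0 1 with hμ
  haveI : ∀ _i : Fin (k + 1 + 1), (gaussianReal (0 : ℝ) 1).IsOpenPosMeasure := fun _ =>
    (gaussianReal_absolutelyContinuous' 0 one_ne_zero).isOpenPosMeasure
  set A : (Fin (k + 1 + 1) → ℝ) → ℝ := fun g =>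
    ((k + 1 + 1 : ℕ) : ℝ) * ((∑ i, g i) / ((k + 1 + 1 : ℕ) : ℝ)) ^ 2 with hA
  set D : (Fin (k + 1 + 1) → ℝ) → ℝ := fun g =>
    (∑ j, (g j - (∑ i, g i) / ((k + 1 + 1 : ℕ) : ℝ)) ^ 2) / (((k + 1 + 1 : ℕ) : ℝ) - 1) with hD
  have hAc : Continuous A := by simp only [hA]; fun_prop
  have hDc : Continuous D := by simp only [hD]; fun_prop
  have haR : (0 : ℝ) < ((k + 1 + 1 : ℕ) : ℝ) := by positivity
  have ha1 : (0 : ℝ) < ((k + 1 + 1 : ℕ) : ℝ) - 1 := by push_cast; linarith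
  have hDnn : ∀ g, 0 ≤ D g := fun g => div_nonneg (Finset.sum_nonneg fun j _ => sq_nonneg _) ha1.le
  intro t₁ ht₁ t₂ ht₂ hlt
  simp only [Set.mem_Ici] at ht₁ ht₂
  have hE1 : MeasurableSet {g : Fin (k + 1 + 1) → ℝ | A g ≤ t₁ ^ 2 * D g} :=
    measurableSet_le hAc.measurable (hDc.measurable.const_mul _)
  have hsub : {g : Fin (k + 1 + 1) → ℝ | A g ≤ t₁ ^ 2 * D g}
      ⊆ {g : Fin (k + 1 + 1) → ℝ | A g ≤ t₂ ^ 2 * D g} := by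
    intro g hg
    simp only [Set.mem_setOf_eq] at hg ⊢
    have : t₁ ^ 2 ≤ t₂ ^ 2 := by nlinarith
    exact hg.trans (mul_le_mul_of_nonneg_right this (hDnn g))
  -- the open set between the two thresholds
  have hU : IsOpen {g : Fin (k + 1 + 1) → ℝ | t₁ ^ 2 * D g < A g ∧ A g < t₂ ^ 2 * D g} :=
    (isOpen_lt (by fun_prop) hAc).inter (isOpen_lt hAc (by fun_prop))
  have hUne : {g : Fin (k + 1 + 1) → ℝ | t₁ ^ 2 * D g < A g ∧ A g < t₂ ^ 2 * D g}.Nonempty := by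
    set τ : ℝ := (t₁ ^ 2 + t₂ ^ 2) / 2 with hτ
    have hτ1 : t₁ ^ 2 < τ := by rw [hτ]; nlinarith
    have hτ2 : τ < t₂ ^ 2 := by rw [hτ]; nlinarith
    have hτ0 : 0 < τ := lt_of_le_of_lt (sq_nonneg _) hτ1
    set x : ℝ := Real.sqrt (2 * τ / (((k + 1 + 1 : ℕ) : ℝ) * (((k + 1 + 1 : ℕ) : ℝ) - 1))) with hx
    have hx2 : x ^ 2 = 2 * τ / (((k + 1 + 1 : ℕ) : ℝ) * (((k + 1 + 1 : ℕ) : ℝ) - 1)) :=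
      Real.sq_sqrt (by positivity)
    refine ⟨Fin.cons (x + 1) (Fin.cons (x - 1) fun _ : Fin k => x), ?_⟩
    obtain ⟨hS, hQ⟩ := student_witness_sums k x
    simp only [Set.mem_setOf_eq, hA, hD]
    rw [hQ, hS]
    have hm : ((k + 1 + 1 : ℕ) : ℝ) * x / ((k + 1 + 1 : ℕ) : ℝ) = x := by field_simp
    rw [hm]
    have hAval : ((k + 1 + 1 : ℕ) : ℝ) * x ^ 2 = 2 * τ / (((k + 1 + 1 : ℕ) : ℝ) - 1) := by
      rw [hx2]; field_simp
    rw [hAval]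
    constructor
    · rw [div_eq_mul_one_div 2, mul_comm (t₁ ^ 2), mul_assoc, div_eq_mul_one_div (2 * τ)]
      have : 0 < 1 / (((k + 1 + 1 : ℕ) : ℝ) - 1) := by positivity
      nlinarith
    · rw [div_eq_mul_one_div 2, mul_comm (t₂ ^ 2), mul_assoc, div_eq_mul_one_div (2 * τ)]
      have : 0 < 1 / (((k + 1 + 1 : ℕ) : ℝ) - 1) := by positivity
      nlinarith
  have hUpos : 0 < μ.real {g : Fin (k + 1 + 1) → ℝ | t₁ ^ 2 * D g < A g ∧ A g < t₂ ^ 2 * D g} := by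
    rw [measureReal_def, ENNReal.toReal_pos_iff]
    exact ⟨hU.measure_pos μ hUne, measure_lt_top _ _⟩
  have hUsub : {g : Fin (k + 1 + 1) → ℝ | t₁ ^ 2 * D g < A g ∧ A g < t₂ ^ 2 * D g}
      ⊆ {g : Fin (k + 1 + 1) → ℝ | A g ≤ t₂ ^ 2 * D g} \ {g : Fin (k + 1 + 1) → ℝ | A g ≤ t₁ ^ 2 * D g} := by
    intro g hg
    simp only [Set.mem_sdiff, Set.mem_setOf_eq, not_le] at hg ⊢
    exact ⟨hg.2.le, hg.1⟩
  have hdiff := measureReal_sdiff (μ := μ) hsub hE1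
  have hle := measureReal_mono (μ := μ) hUsub
  show μ.real {g : Fin (k + 1 + 1) → ℝ | A g ≤ t₁ ^ 2 * D g} < μ.real {g : Fin (k + 1 + 1) → ℝ | A g ≤ t₂ ^ 2 * D g}
  linarith

/-- Hence a Student-type threshold realising a given value of `F_a` is UNIQUE in `[0, ∞)`. [ours] -/
theorem injOn_pi_gaussianReal_student {a : ℕ} (ha : 2 ≤ a) :
    Set.InjOn (fun t : ℝ => (Measure.pi fun _ : Fin a => gaussianReal 0 1).real
      {g : Fin a → ℝ | (a : ℝ) * ((∑ i, g i) / (a : ℝ)) ^ 2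
          ≤ t ^ 2 * ((∑ j, (g j - (∑ i, g i) / (a : ℝ)) ^ 2) / ((a : ℝ) - 1))}) (Set.Ici 0) :=
  (strictMonoOn_pi_gaussianReal_student ha).injOn

/-- **`F⁽²⁾_a` IS STRICTLY INCREASING ON `[0, ∞)`** (`a ≥ 2`; the two-run / two-arm functional). [ours] -/
theorem strictMonoOn_pi_gaussianReal_twoSample_student {a : ℕ} (ha : 2 ≤ a) :
    StrictMonoOn (fun t : ℝ => ((Measure.pi fun _ : Fin a => gaussianReal 0 1).prod
        (Measure.pi fun _ : Fin a => gaussianReal 0 1)).real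
      {p : (Fin a → ℝ) × (Fin a → ℝ) | (a : ℝ) * ((∑ i, p.1 i) / (a : ℝ) - (∑ i, p.2 i) / (a : ℝ)) ^ 2
          ≤ t ^ 2 * (((∑ j, (p.1 j - (∑ i, p.1 i) / (a : ℝ)) ^ 2) / ((a : ℝ) - 1))
            + ((∑ j, (p.2 j - (∑ i, p.2 i) / (a : ℝ)) ^ 2) / ((a : ℝ) - 1)))}) (Set.Ici 0) := by
  obtain ⟨k, rfl⟩ : ∃ k, a = k + 1 + 1 := ⟨a - 2, by omega⟩
  set μ := (Measure.pi fun _ : Fin (k + 1 + 1) => gaussianReal 0 1).prod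
      (Measure.pi fun _ : Fin (k + 1 + 1) => gaussianReal 0 1) with hμ
  haveI : ∀ _i : Fin (k + 1 + 1), (gaussianReal (0 : ℝ) 1).IsOpenPosMeasure := fun _ =>
    (gaussianReal_absolutelyContinuous' 0 one_ne_zero).isOpenPosMeasure
  set A : (Fin (k + 1 + 1) → ℝ) × (Fin (k + 1 + 1) → ℝ) → ℝ := fun p =>
    ((k + 1 + 1 : ℕ) : ℝ) * ((∑ i, p.1 i) / ((k + 1 + 1 : ℕ) : ℝ)
      - (∑ i, p.2 i) / ((k + 1 + 1 : ℕ) : ℝ)) ^ 2 with hA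
  set D : (Fin (k + 1 + 1) → ℝ) × (Fin (k + 1 + 1) → ℝ) → ℝ := fun p =>
    ((∑ j, (p.1 j - (∑ i, p.1 i) / ((k + 1 + 1 : ℕ) : ℝ)) ^ 2) / (((k + 1 + 1 : ℕ) : ℝ) - 1))
      + ((∑ j, (p.2 j - (∑ i, p.2 i) / ((k + 1 + 1 : ℕ) : ℝ)) ^ 2) / (((k + 1 + 1 : ℕ) : ℝ) - 1))
    with hD
  have hAc : Continuous A := by simp only [hA]; fun_prop
  have hDc : Continuous D := by simp only [hD]; fun_prop
  have haR : (0 : ℝ) < ((k + 1 + 1 : ℕ) : ℝ) := by positivity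
  have ha1 : (0 : ℝ) < ((k + 1 + 1 : ℕ) : ℝ) - 1 := by push_cast; linarith
  have hDnn : ∀ p, 0 ≤ D p := fun p =>
    add_nonneg (div_nonneg (Finset.sum_nonneg fun j _ => sq_nonneg _) ha1.le)
      (div_nonneg (Finset.sum_nonneg fun j _ => sq_nonneg _) ha1.le)
  intro t₁ ht₁ t₂ ht₂ hlt
  simp only [Set.mem_Ici] at ht₁ ht₂
  have hE1 : MeasurableSet {p : (Fin (k + 1 + 1) → ℝ) × (Fin (k + 1 + 1) → ℝ) | A p ≤ t₁ ^ 2 * D p} :=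
    measurableSet_le hAc.measurable (hDc.measurable.const_mul _)
  have hsub : {p : (Fin (k + 1 + 1) → ℝ) × (Fin (k + 1 + 1) → ℝ) | A p ≤ t₁ ^ 2 * D p}
      ⊆ {p : (Fin (k + 1 + 1) → ℝ) × (Fin (k + 1 + 1) → ℝ) | A p ≤ t₂ ^ 2 * D p} := by
    intro p hp
    simp only [Set.mem_setOf_eq] at hp ⊢
    have : t₁ ^ 2 ≤ t₂ ^ 2 := by nlinarith
    exact hp.trans (mul_le_mul_of_nonneg_right this (hDnn p))
  have hU : IsOpen {p : (Fin (k + 1 + 1) → ℝ) × (Fin (k + 1 + 1) → ℝ) |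
      t₁ ^ 2 * D p < A p ∧ A p < t₂ ^ 2 * D p} :=
    (isOpen_lt (by fun_prop) hAc).inter (isOpen_lt hAc (by fun_prop))
  have hUne : {p : (Fin (k + 1 + 1) → ℝ) × (Fin (k + 1 + 1) → ℝ) |
      t₁ ^ 2 * D p < A p ∧ A p < t₂ ^ 2 * D p}.Nonempty := by
    set τ : ℝ := (t₁ ^ 2 + t₂ ^ 2) / 2 with hτ
    have hτ1 : t₁ ^ 2 < τ := by rw [hτ]; nlinarith
    have hτ2 : τ < t₂ ^ 2 := by rw [hτ]; nlinarith
    have hτ0 : 0 < τ := lt_of_le_of_lt (sq_nonneg _) hτ1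
    set x : ℝ := Real.sqrt (2 * τ / (((k + 1 + 1 : ℕ) : ℝ) * (((k + 1 + 1 : ℕ) : ℝ) - 1))) with hx
    have hx2 : x ^ 2 = 2 * τ / (((k + 1 + 1 : ℕ) : ℝ) * (((k + 1 + 1 : ℕ) : ℝ) - 1)) :=
      Real.sq_sqrt (by positivity)
    refine ⟨(Fin.cons (x + 1) (Fin.cons (x - 1) fun _ : Fin k => x), fun _ => (0 : ℝ)), ?_⟩
    obtain ⟨hS, hQ⟩ := student_witness_sums k x
    simp only [Set.mem_setOf_eq, hA, hD]
    rw [hQ, hS]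
    simp only [Finset.sum_const_zero, zero_div, sub_zero, ne_eq, OfNat.ofNat_ne_zero,
      not_false_eq_true, zero_pow, add_zero]
    have hm : ((k + 1 + 1 : ℕ) : ℝ) * x / ((k + 1 + 1 : ℕ) : ℝ) = x := by field_simp
    rw [hm]
    have hAval : ((k + 1 + 1 : ℕ) : ℝ) * x ^ 2 = 2 * τ / (((k + 1 + 1 : ℕ) : ℝ) - 1) := by
      rw [hx2]; field_simp
    rw [hAval]
    constructor
    · rw [div_eq_mul_one_div 2, mul_comm (t₁ ^ 2), mul_assoc, div_eq_mul_one_div (2 * τ)]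
      have : 0 < 1 / (((k + 1 + 1 : ℕ) : ℝ) - 1) := by positivity
      nlinarith
    · rw [div_eq_mul_one_div 2, mul_comm (t₂ ^ 2), mul_assoc, div_eq_mul_one_div (2 * τ)]
      have : 0 < 1 / (((k + 1 + 1 : ℕ) : ℝ) - 1) := by positivity
      nlinarith
  haveI hpos : μ.IsOpenPosMeasure := Measure.prod.instIsOpenPosMeasure
  have hUpos : 0 < μ.real {p : (Fin (k + 1 + 1) → ℝ) × (Fin (k + 1 + 1) → ℝ) |
      t₁ ^ 2 * D p < A p ∧ A p < t₂ ^ 2 * D p} := by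
    rw [measureReal_def, ENNReal.toReal_pos_iff]
    exact ⟨hU.measure_pos μ hUne, measure_lt_top _ _⟩
  have hUsub : {p : (Fin (k + 1 + 1) → ℝ) × (Fin (k + 1 + 1) → ℝ) |
        t₁ ^ 2 * D p < A p ∧ A p < t₂ ^ 2 * D p}
      ⊆ {p : (Fin (k + 1 + 1) → ℝ) × (Fin (k + 1 + 1) → ℝ) | A p ≤ t₂ ^ 2 * D p}
        \ {p : (Fin (k + 1 + 1) → ℝ) × (Fin (k + 1 + 1) → ℝ) | A p ≤ t₁ ^ 2 * D p} := by
    intro p hp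
    simp only [Set.mem_sdiff, Set.mem_setOf_eq, not_le] at hp ⊢
    exact ⟨hp.2.le, hp.1⟩
  have hdiff := measureReal_sdiff (μ := μ) hsub hE1
  have hle := measureReal_mono (μ := μ) hUsub
  show μ.real {p : (Fin (k + 1 + 1) → ℝ) × (Fin (k + 1 + 1) → ℝ) | A p ≤ t₁ ^ 2 * D p}
    < μ.real {p : (Fin (k + 1 + 1) → ℝ) × (Fin (k + 1 + 1) → ℝ) | A p ≤ t₂ ^ 2 * D p}
  linarith

/-- Hence a two-sample Student-type threshold realising a given value of `F⁽²⁾_a` is UNIQUE in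
`[0, ∞)`. [ours] -/
theorem injOn_pi_gaussianReal_twoSample_student {a : ℕ} (ha : 2 ≤ a) :
    Set.InjOn (fun t : ℝ => ((Measure.pi fun _ : Fin a => gaussianReal 0 1).prod
        (Measure.pi fun _ : Fin a => gaussianReal 0 1)).real
      {p : (Fin a → ℝ) × (Fin a → ℝ) | (a : ℝ) * ((∑ i, p.1 i) / (a : ℝ) - (∑ i, p.2 i) / (a : ℝ)) ^ 2
          ≤ t ^ 2 * (((∑ j, (p.1 j - (∑ i, p.1 i) / (a : ℝ)) ^ 2) / ((a : ℝ) - 1))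
            + ((∑ j, (p.2 j - (∑ i, p.2 i) / (a : ℝ)) ^ 2) / ((a : ℝ) - 1)))}) (Set.Ici 0) :=
  (strictMonoOn_pi_gaussianReal_twoSample_student ha).injOn

end Monotone

end Summit.Ventures.LatticeQCDFlow.Scoring
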